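import Summits.AtomisticToContinuum.Crystallization.Theorems.ThreeConeCertificateSlackRigidityPricedFloorsS3Defs2
import Summits.AtomisticToContinuum.Crystallization.Theorems.PhononSlackCertificatesPeriodicGivenLayeredLayerCake1
import Summits.AtomisticToContinuum.Crystallization.Theorems.PhononSlackCertificatesPeriodicGivenLayeredExtraction1
import HarnessLib

/-!
# `SlackRigidity` (stmt-AtomisticToContinuum-11960), line `priced-floors-palm-exactification`, stub S3
# (`stub_layeredMeanSelection`): geometry of the canonical layer transport, part 1 (targets)

Lead c19, S3 transport geometry.  For normal-form layering data `e = (T, a, s, z)` the pattern points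
are `pointOf e m i j = T (i u + j v + L(m) w + z(m) e₃)` (`L = haggLabel s`, `T` an isometry).  This
file proves:

* `pointOf_rerootData` — re-indexing the layers at `m₀` (and the in-plane lattice at `(i₀, j₀)`) is the
  translation by `-pointOf e m₀ i₀ j₀`; hence `dataSet (rerootData e m) = (· - pointOf e m i j) '' dataSet e`
  and `lms_rerootData_fits` (registered sub-goal (T1));
* `pointOf_injective`, `layer_unique` — the parametrisation of normal data is injective and the layers
  are disjoint (heights are strictly increasing); `card_nearCodes`, `card_layerTargets`;
* `lms_layerTargets_char` (T2) — the targets of layer `m` (the points with in-plane codes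
  `nearCodes (L m)`) are exactly the points of the layer NEAREST TO THE ROOT, one in aligned registry
  (`L m ≡ 0 mod 3`) and three in hole registry.  Since `T` is an isometry and `e₃ ⊥ u, v, w`,
  `‖T (i u + j v + L w + z e₃)‖² = (a²/9)·Q(3i + L, 3j + L) + z²` with the triangular form
  `Q(X, Y) = X² + XY + Y²` (`norm_pointOf_sq`), so this is the integer problem of minimising `Q` on the
  coset `X ≡ Y ≡ L (mod 3)`: minimum `0` at `X = Y = 0` if `L ≡ 0`, minimum `3` at
  `(1,1), (-2,1), (1,-2)` (resp. their negatives) if `L ≡ 1` (resp. `2`) — `mem_nearCodes_iff`;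
* `lms_transport_invariant` (T4) — consequently the targets depend only on the layer as a SET, so under
  `LayerRigid` the transport weight does not depend on the presentation.

All `[folklore]` bookkeeping.
-/

noncomputable section

open MeasureTheory Filter Set
open scoped ENNReal BigOperators Topology

namespace Summit.AtomisticToContinuum.Crystallization.Theorems.SlackRigidityPricedFloorsTransport

open Literature.MathematicalPhysics.StatisticalMechanics
open Summit.AtomisticToContinuum.Crystallization.Theorems.SlackRigidityPricedFloors
open Summit.AtomisticToContinuum.Crystallization.Theorems.LayeredHull

/-! ## Re-rooting is a translation -/

/-- The point `(n, i, j)` of the data re-rooted at layer `m₀` is the point `(n + m₀, i + i₀, j + j₀)` of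
the data translated by `-pointOf e m₀ i₀ j₀`, for every in-plane index `(i₀, j₀)`. [folklore] -/
theorem pointOf_rerootData (e : LData) (m₀ n i j i₀ j₀ : ℤ) :
    pointOf (rerootData e m₀) n i j = pointOf e (n + m₀) (i + i₀) (j + j₀) - pointOf e m₀ i₀ j₀ := by
  obtain ⟨T, a, s, z⟩ := e
  simp only [pointOf, rerootData]
  rw [← map_sub, ext_haggLabel_shift]
  congr 1
  push_cast
  module

/-- Layers of re-rooted data are translated layers. [folklore] -/
theorem layerOf_rerootData (e : LData) (m₀ n i₀ j₀ : ℤ) :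
    layerOf (rerootData e m₀) n = (fun x => x - pointOf e m₀ i₀ j₀) '' layerOf e (n + m₀) := by
  ext x
  simp only [layerOf, mem_setOf_eq, mem_image]
  constructor
  · rintro ⟨i, j, rfl⟩
    exact ⟨_, ⟨i + i₀, j + j₀, rfl⟩, (pointOf_rerootData e m₀ n i j i₀ j₀).symm⟩
  · rintro ⟨_, ⟨i, j, rfl⟩, rfl⟩
    refine ⟨i - i₀, j - j₀, ?_⟩
    rw [pointOf_rerootData _ m₀ n _ _ i₀ j₀, sub_add_cancel, sub_add_cancel]

/-- The layered set of re-rooted data is the translated layered set. [folklore] -/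
theorem dataSet_rerootData (e : LData) (m₀ i₀ j₀ : ℤ) :
    dataSet (rerootData e m₀) = (fun x => x - pointOf e m₀ i₀ j₀) '' dataSet e := by
  rw [dataSet_eq_iUnion_layerOf, dataSet_eq_iUnion_layerOf, image_iUnion]
  ext x
  simp only [mem_iUnion]
  constructor
  · rintro ⟨n, hn⟩
    exact ⟨n + m₀, by rwa [← layerOf_rerootData]⟩
  · rintro ⟨n, hn⟩
    refine ⟨n - m₀, ?_⟩
    rwa [layerOf_rerootData _ _ _ i₀ j₀, sub_add_cancel]

/-- **(T1) Re-rooting fits the translated set** (registered sub-goal `lms_rerootData_fits`): the data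
re-rooted at layer `m` fit `S - pointOf e m i j` whenever `e` fits `S`. [folklore] -/
theorem lms_rerootData_fits : ∀ (S : Set E3) (e : LData) (m i j : ℤ), Fits S e → Fits ((fun x => x - pointOf e m i j) '' S) (rerootData e m) := by
  rintro S e m i j ⟨he, rfl⟩
  exact ⟨isNormalData_rerootData he m, dataSet_rerootData e m i j⟩

/-! ## Normal data: injectivity of the parametrisation -/

/-- The spacing of normal data is positive. [folklore] -/
theorem spacing_pos {e : LData} (he : IsNormalData e) : 0 < e.2.1 := by
  linarith [he.2.1.1]

/-- The heights of normal data are injective. [folklore] -/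
theorem height_injective {e : LData} (he : IsNormalData e) : Function.Injective e.2.2.2 :=
  cake_height_injective e.2.1 (spacing_pos he) e.2.2.2 fun m => (he.2.1.2.2.2 m).1

/-- A pattern point is the frame applied to a `layerVec`. [folklore] -/
theorem pointOf_eq (e : LData) (m i j : ℤ) :
    pointOf e m i j = e.1 (layerVec e.2.1 (e.2.2.2 m) (haggLabel e.2.2.1 m) 1 i j) := by
  rw [pointOf, cake_pt_eq_layerVec]

/-- The norm of a pattern point of normal data. [folklore] -/
theorem norm_pointOf {e : LData} (he : IsNormalData e) (m i j : ℤ) :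
    ‖pointOf e m i j‖ = ‖layerVec e.2.1 (e.2.2.2 m) (haggLabel e.2.2.1 m) 1 i j‖ := by
  rw [pointOf_eq, he.1]

/-- **Injectivity of the parametrisation** of normal data. [folklore] -/
theorem pointOf_injective {e : LData} (he : IsNormalData e) {m i j m' i' j' : ℤ}
    (h : pointOf e m i j = pointOf e m' i' j') : m = m' ∧ i = i' ∧ j = j' := by
  have hinj : Function.Injective e.1 := fun x y hxy => by
    have := he.1 (x - y)
    rw [map_sub, hxy, sub_self, norm_zero] at this
    exact sub_eq_zero.1 (norm_eq_zero.1 this.symm)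
  rw [pointOf_eq, pointOf_eq] at h
  exact cake_param_injective e.2.1 (spacing_pos he).ne' _ e.2.2.2 (height_injective he) (hinj h)

/-- Pattern points lie on their layer. [folklore] -/
theorem pointOf_mem_layerOf (e : LData) (m i j : ℤ) : pointOf e m i j ∈ layerOf e m := ⟨i, j, rfl⟩

/-- **Layers of normal data are disjoint.** [folklore] -/
theorem layer_unique {e : LData} (he : IsNormalData e) {m m' : ℤ} {p : E3}
    (hm : p ∈ layerOf e m) (hm' : p ∈ layerOf e m') : m = m' := by
  obtain ⟨i, j, rfl⟩ := hm
  obtain ⟨i', j', h⟩ := hm'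
  exact (pointOf_injective he h).1

/-! ## Targets: codes and cardinalities -/

/-- `nearCodes L` has one element in aligned registry and three in hole registry. [folklore] -/
theorem card_nearCodes (L : ℤ) : (nearCodes L).card = if L % 3 = 0 then 1 else 3 := by
  unfold nearCodes
  split_ifs with h0 h1
  · rfl
  · exact Finset.card_eq_three.2 ⟨_, _, _, by simp only [ne_eq, Prod.mk.injEq]; omega,
      by simp only [ne_eq, Prod.mk.injEq]; omega, by simp only [ne_eq, Prod.mk.injEq]; omega, rfl⟩
  · exact Finset.card_eq_three.2 ⟨_, _, _, by simp only [ne_eq, Prod.mk.injEq]; omega,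
      by simp only [ne_eq, Prod.mk.injEq]; omega, by simp only [ne_eq, Prod.mk.injEq]; omega, rfl⟩

/-- Membership of a pattern point in the targets of its layer is membership of its code in
`nearCodes` (normal data). [folklore] -/
theorem pointOf_mem_layerTargets_iff {e : LData} (he : IsNormalData e) (m i j : ℤ) :
    pointOf e m i j ∈ layerTargets e m ↔ (i, j) ∈ nearCodes (haggLabel e.2.2.1 m) := by
  rw [layerTargets, Finset.mem_image]
  constructor
  · rintro ⟨⟨i', j'⟩, hij, h⟩
    obtain ⟨-, rfl, rfl⟩ := pointOf_injective he h
    exact hij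
  · intro h
    exact ⟨(i, j), h, rfl⟩

/-- The number of targets in layer `m` of normal data. [folklore] -/
theorem card_layerTargets {e : LData} (he : IsNormalData e) (m : ℤ) :
    (layerTargets e m).card = if haggLabel e.2.2.1 m % 3 = 0 then 1 else 3 := by
  rw [layerTargets, Finset.card_image_of_injective _ (fun ij ij' h => ?_), card_nearCodes]
  obtain ⟨-, h1, h2⟩ := pointOf_injective he h
  exact Prod.ext h1 h2

/-! ## The triangular form on the cosets modulo `3` -/

/-- Small values: `X² + XY + Y² ≤ 3` forces `|X|, |Y| ≤ 2`. [folklore] -/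
theorem form_le_three {X Y : ℤ} (h : X ^ 2 + X * Y + Y ^ 2 ≤ 3) :
    -2 ≤ X ∧ X ≤ 2 ∧ -2 ≤ Y ∧ Y ≤ 2 := by
  refine ⟨?_, ?_, ?_, ?_⟩ <;> nlinarith [sq_nonneg (2 * X + Y), sq_nonneg (X + 2 * Y)]

/-- On the cosets `X ≡ Y ≡ r (mod 3)`, `r ≠ 0`, the form is `≥ 3` (it is `≥ 1` and divisible by `3`).
[folklore] -/
theorem three_le_form {X Y : ℤ} (hX : X % 3 ≠ 0) (hXY : X % 3 = Y % 3) :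
    3 ≤ X ^ 2 + X * Y + Y ^ 2 := by
  obtain ⟨A, B, r, rfl, rfl⟩ : ∃ A B r : ℤ, X = 3 * A + r ∧ Y = 3 * B + r :=
    ⟨X / 3, Y / 3, X % 3, by omega, by omega⟩
  have h1 : 1 ≤ (3 * A + r) ^ 2 + (3 * A + r) * (3 * B + r) + (3 * B + r) ^ 2 := by
    refine one_le_sq_add_mul_add_sq fun h0 => hX ?_
    rw [(Prod.mk_eq_zero.1 h0).1]
    decide
  have hG : (3 * A + r) ^ 2 + (3 * A + r) * (3 * B + r) + (3 * B + r) ^ 2 =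
      3 * (3 * A ^ 2 + 3 * A * B + 3 * B ^ 2 + 3 * r * A + 3 * r * B + r ^ 2) := by ring
  rw [hG] at h1 ⊢
  generalize 3 * A ^ 2 + 3 * A * B + 3 * B ^ 2 + 3 * r * A + 3 * r * B + r ^ 2 = t at h1 ⊢
  omega

/-- The points of the coset `X ≡ Y ≡ 1` with form `≤ 3`. [folklore] -/
theorem form_le_three_coset_one {X Y : ℤ} (hX : X % 3 = 1) (hY : Y % 3 = 1)
    (h : X ^ 2 + X * Y + Y ^ 2 ≤ 3) : (X = 1 ∧ Y = 1) ∨ (X = -2 ∧ Y = 1) ∨ (X = 1 ∧ Y = -2) := by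
  obtain ⟨h1, h2, h3, h4⟩ := form_le_three h
  have hX' : X = 1 ∨ X = -2 := by omega
  have hY' : Y = 1 ∨ Y = -2 := by omega
  rcases hX' with rfl | rfl <;> rcases hY' with rfl | rfl <;> simp_all

/-- The points of the coset `X ≡ Y ≡ 2` with form `≤ 3`. [folklore] -/
theorem form_le_three_coset_two {X Y : ℤ} (hX : X % 3 = 2) (hY : Y % 3 = 2)
    (h : X ^ 2 + X * Y + Y ^ 2 ≤ 3) :
    (X = -1 ∧ Y = -1) ∨ (X = 2 ∧ Y = -1) ∨ (X = -1 ∧ Y = 2) := by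
  obtain ⟨h1, h2, h3, h4⟩ := form_le_three h
  have hX' : X = -1 ∨ X = 2 := by omega
  have hY' : Y = -1 ∨ Y = 2 := by omega
  rcases hX' with rfl | rfl <;> rcases hY' with rfl | rfl <;> simp_all

/-- **The near codes are the minimisers of the planar form**: `(i, j) ∈ nearCodes L` iff
`Q(3i + L, 3j + L)` is minimal over `ℤ²`. [folklore] -/
theorem mem_nearCodes_iff (L i j : ℤ) : (i, j) ∈ nearCodes L ↔ ∀ i' j' : ℤ,
    (3 * i + L) ^ 2 + (3 * i + L) * (3 * j + L) + (3 * j + L) ^ 2 ≤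
      (3 * i' + L) ^ 2 + (3 * i' + L) * (3 * j' + L) + (3 * j' + L) ^ 2 := by
  obtain ⟨q, r, rfl, hr⟩ : ∃ q r : ℤ, L = 3 * q + r ∧ (r = 0 ∨ r = 1 ∨ r = 2) :=
    ⟨L / 3, L % 3, by omega, by omega⟩
  have hq : (3 * q + r) / 3 = q := by omega
  have hr' : (3 * q + r) % 3 = r := by omega
  simp only [nearCodes, hq, hr']
  rcases hr with rfl | rfl | rfl
  · rw [if_pos rfl, Finset.mem_singleton, Prod.mk.injEq]
    constructor
    · rintro ⟨rfl, rfl⟩ i' j'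
      nlinarith [sq_nonneg (2 * (3 * i' + (3 * q + 0)) + (3 * j' + (3 * q + 0))),
        sq_nonneg (3 * j' + (3 * q + 0))]
    · intro h
      have h0 : (3 * i + (3 * q + 0)) ^ 2 + (3 * i + (3 * q + 0)) * (3 * j + (3 * q + 0)) +
          (3 * j + (3 * q + 0)) ^ 2 ≤ 0 := by nlinarith [h (-q) (-q)]
      by_contra hne
      have h1 : 1 ≤ (i + q) ^ 2 + (i + q) * (j + q) + (j + q) ^ 2 := by
        refine one_le_sq_add_mul_add_sq fun h0 => hne ?_
        have := Prod.mk_eq_zero.1 h0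
        omega
      nlinarith
  · rw [if_neg (by decide), if_pos rfl]
    simp only [Finset.mem_insert, Finset.mem_singleton, Prod.mk.injEq]
    constructor
    · intro h i' j'
      have h3 := three_le_form (X := 3 * i' + (3 * q + 1)) (Y := 3 * j' + (3 * q + 1))
        (by omega) (by omega)
      rcases h with ⟨rfl, rfl⟩ | ⟨rfl, rfl⟩ | ⟨rfl, rfl⟩ <;> nlinarith [h3]
    · intro h
      have hle : (3 * i + (3 * q + 1)) ^ 2 + (3 * i + (3 * q + 1)) * (3 * j + (3 * q + 1)) +
          (3 * j + (3 * q + 1)) ^ 2 ≤ 3 := by nlinarith [h (-q) (-q)]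
      rcases form_le_three_coset_one (by omega) (by omega) hle with h1 | h1 | h1 <;> omega
  · rw [if_neg (by decide), if_neg (by decide)]
    simp only [Finset.mem_insert, Finset.mem_singleton, Prod.mk.injEq]
    constructor
    · intro h i' j'
      have h3 := three_le_form (X := 3 * i' + (3 * q + 2)) (Y := 3 * j' + (3 * q + 2))
        (by omega) (by omega)
      rcases h with ⟨rfl, rfl⟩ | ⟨rfl, rfl⟩ | ⟨rfl, rfl⟩ <;> nlinarith [h3]
    · intro h
      have hle : (3 * i + (3 * q + 2)) ^ 2 + (3 * i + (3 * q + 2)) * (3 * j + (3 * q + 2)) +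
          (3 * j + (3 * q + 2)) ^ 2 ≤ 3 := by nlinarith [h (-q - 1) (-q - 1)]
      rcases form_le_three_coset_two (by omega) (by omega) hle with h1 | h1 | h1 <;> omega

/-! ## Norms of pattern points -/

/-- **Squared norm of a pattern point** of normal data in coordinates:
`‖pointOf e m i j‖² = (a²/9)·Q(3i + L, 3j + L) + z(m)²`. [folklore] -/
theorem norm_pointOf_sq {e : LData} (he : IsNormalData e) (m i j : ℤ) :
    ‖pointOf e m i j‖ ^ 2 = e.2.1 ^ 2 / 9 * (((3 * i + haggLabel e.2.2.1 m) ^ 2 +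
      (3 * i + haggLabel e.2.2.1 m) * (3 * j + haggLabel e.2.2.1 m) +
      (3 * j + haggLabel e.2.2.1 m) ^ 2 : ℤ) : ℝ) + e.2.2.2 m ^ 2 := by
  rw [norm_pointOf he, norm_layerVec, Real.sq_sqrt (by positivity)]
  have h3 : (√3 : ℝ) ^ 2 = 3 := Real.sq_sqrt (by norm_num)
  push_cast
  linear_combination (e.2.1 ^ 2 / 4 * ((j : ℝ) + (haggLabel e.2.2.1 m : ℝ) / 3) ^ 2) * h3

/-- Comparing norms within a layer is comparing the planar form. [folklore] -/
theorem norm_pointOf_le_iff {e : LData} (he : IsNormalData e) (m i j i' j' : ℤ) :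
    ‖pointOf e m i j‖ ≤ ‖pointOf e m i' j'‖ ↔
      (3 * i + haggLabel e.2.2.1 m) ^ 2 +
          (3 * i + haggLabel e.2.2.1 m) * (3 * j + haggLabel e.2.2.1 m) +
          (3 * j + haggLabel e.2.2.1 m) ^ 2 ≤
        (3 * i' + haggLabel e.2.2.1 m) ^ 2 +
          (3 * i' + haggLabel e.2.2.1 m) * (3 * j' + haggLabel e.2.2.1 m) +
          (3 * j' + haggLabel e.2.2.1 m) ^ 2 := by
  have ha : (0 : ℝ) < e.2.1 ^ 2 / 9 := by have := spacing_pos he; positivity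
  rw [← sq_le_sq₀ (norm_nonneg _) (norm_nonneg _), norm_pointOf_sq he, norm_pointOf_sq he,
    add_le_add_iff_right, mul_le_mul_iff_right₀ ha, Int.cast_le]

/-! ## (T2) The targets are the points of the layer nearest to the root -/

/-- **(T2) Characterisation of the targets** (registered sub-goal `lms_layerTargets_char`): the
targets of layer `m` are exactly its points of minimal norm, one in aligned and three in hole
registry. [folklore] -/
theorem lms_layerTargets_char : ∀ (e : LData), IsNormalData e → ∀ m : ℤ, (↑(layerTargets e m) : Set E3) = {p | p ∈ layerOf e m ∧ ∀ q ∈ layerOf e m, ‖p‖ ≤ ‖q‖} ∧ (layerTargets e m).card = (if haggLabel e.2.2.1 m % 3 = 0 then 1 else 3) := by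
  intro e he m
  refine ⟨?_, card_layerTargets he m⟩
  ext p
  simp only [Finset.mem_coe, mem_setOf_eq]
  constructor
  · intro hp
    obtain ⟨⟨i, j⟩, hij, rfl⟩ := Finset.mem_image.1 hp
    refine ⟨pointOf_mem_layerOf e m i j, ?_⟩
    rintro q ⟨i', j', rfl⟩
    exact (norm_pointOf_le_iff he m i j i' j').2 ((mem_nearCodes_iff _ i j).1 hij i' j')
  · rintro ⟨⟨i, j, rfl⟩, hmin⟩
    exact (pointOf_mem_layerTargets_iff he m i j).2 ((mem_nearCodes_iff _ i j).2 fun i' j' =>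
      (norm_pointOf_le_iff he m i j i' j').1 (hmin _ (pointOf_mem_layerOf e m i' j')))

/-- The targets depend only on the layer as a set (normal data). [folklore] -/
theorem layerTargets_eq_of_layerOf_eq {e e' : LData} (he : IsNormalData e) (he' : IsNormalData e')
    {m m' : ℤ} (h : layerOf e' m' = layerOf e m) : layerTargets e' m' = layerTargets e m := by
  apply Finset.coe_injective
  rw [(lms_layerTargets_char e' he' m').1, (lms_layerTargets_char e he m).1, h]

/-! ## (T4) Presentation invariance of the transport weight -/

/-- **(T4) Invariance** (registered sub-goal `lms_transport_invariant`): under `LayerRigid S` the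
transport weight does not depend on the data fitting `S`. [folklore] -/
theorem lms_transport_invariant : ∀ (S : Set E3), LayerRigid S → ∀ (e e' : LData), Fits S e → Fits S e' → ∀ (k : ℕ) (y : E3), transportWeight k e y = transportWeight k e' y := by
  intro S hR e e' he he' k y
  rcases hR e e' he he' with h | h
  · rw [transportWeight, transportWeight, layerTargets_eq_of_layerOf_eq he.1 he'.1 (h k),
      layerTargets_eq_of_layerOf_eq he.1 he'.1 (h (-(k : ℤ)))]
  · rw [transportWeight, transportWeight, layerTargets_eq_of_layerOf_eq he.1 he'.1 (h k),
      layerTargets_eq_of_layerOf_eq he.1 he'.1 ((h (-(k : ℤ))).trans (by rw [neg_neg])), add_comm]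

end Summit.AtomisticToContinuum.Crystallization.Theorems.SlackRigidityPricedFloorsTransport

end
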